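import Literature.MeasureTheory.Covering.DyadicDensity
import HarnessLib

/-!
# The Calderón–Zygmund cube selection for an indicator (Gilbarg–Trudinger, §9.2, (9.20))

For a measurable `Γ` inside the unit cube `K₀ = [0,1)ⁿ` with `|Γ| ≤ t|K₀|`, `t < 1`, run the dyadic
stopping time on `χ_Γ`: a dyadic cube `Q ⊆ K₀` is **selected** if `|Γ ∩ Q| > t|Q|` while no strict
dyadic ancestor is that dense. Then

* `volume_diff_selectedUnion` — `|Γ ∖ F| = 0`, `F = ⋃` selected cubes ((9.18): almost every point
  of `Γ` lies in a dense dyadic cube, and the minimal one is selected);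
* parents of selected cubes are non-dense subcubes of `K₀`, the maximal parents are pairwise
  disjoint and exhaust `F̃ = ⋃` parents, whence `|Γ ∩ F̃| ≤ t|F̃|` ((9.19));
* `volume_le_mul_volume_parentUnion` — **(9.20)**: `|Γ| ≤ t |F̃|`.

This is the measure-theoretic input of Lemma 9.23 (and so of the Krylov–Safonov weak Harnack
inequality, Thm. 9.22) needed for the Evans–Krylov step of
`Literature.Geometry.Riemannian.gurskyViaclovsky_pathClosed_weighted_four`.

## References

* D. Gilbarg, N. S. Trudinger, *Elliptic Partial Differential Equations of Second Order* (2001),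
  §9.2, (9.16)–(9.20). [GilbargTrudinger2001]
-/

noncomputable section

open Set MeasureTheory Filter
open scoped ENNReal

namespace Literature.MeasureTheory.Covering.Dyadic

variable {ι : Type*} [Fintype ι]

omit [Fintype ι] in
/-- The unit cube `K₀ = [0,1)ⁿ` is the dyadic cube of generation `0` and index `0`. [folklore] -/
theorem unitCube_eq : dyadicCube (ι := ι) 0 0 = Set.pi univ fun _ ↦ Ico (0 : ℝ) 1 := by
  ext x; simp [dyadicCube, Set.mem_pi]

/-- A cube `Q` is `t`-dense for `Γ` when `t|Q| < |Γ ∩ Q|`. [cite: GilbargTrudinger2001, §9.2, (9.16)] -/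
def IsDense (t : ℝ≥0∞) (Γ : Set (ι → ℝ)) (k : ℕ) (m : ι → ℤ) : Prop :=
  t * volume (dyadicCube k m) < volume (Γ ∩ dyadicCube k m)

/-- **Selected cubes** of the stopping time: dense subcubes of `K₀` none of whose strict dyadic
ancestors is dense. [cite: GilbargTrudinger2001, §9.2 (the family `𝒮`)] -/
def Selected (t : ℝ≥0∞) (Γ : Set (ι → ℝ)) (k : ℕ) (m : ι → ℤ) : Prop :=
  dyadicCube k m ⊆ dyadicCube 0 0 ∧ IsDense t Γ k m ∧
    ∀ k' m', k' < k → dyadicCube k m ⊆ dyadicCube k' m' → ¬ IsDense t Γ k' m'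

/-- `F = ⋃` selected cubes. [cite: GilbargTrudinger2001, §9.2 (the set `F`)] -/
def selectedUnion (t : ℝ≥0∞) (Γ : Set (ι → ℝ)) : Set (ι → ℝ) :=
  ⋃ (k : ℕ) (m : ι → ℤ) (_ : Selected t Γ k m), dyadicCube k m

/-- **Parents of selected cubes** (generation `k`): `Q_{k,⌊m/2⌋}` for a selected `Q_{k+1,m}`.
[cite: GilbargTrudinger2001, §9.2 (the cubes `K̃`)] -/
def IsParent (t : ℝ≥0∞) (Γ : Set (ι → ℝ)) (k : ℕ) (m : ι → ℤ) : Prop :=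
  ∃ m', Selected t Γ (k + 1) m' ∧ parentIndex m' = m

/-- `F̃ = ⋃` parents of selected cubes. [cite: GilbargTrudinger2001, §9.2 (the set `F̃`)] -/
def parentUnion (t : ℝ≥0∞) (Γ : Set (ι → ℝ)) : Set (ι → ℝ) :=
  ⋃ (k : ℕ) (m : ι → ℤ) (_ : IsParent t Γ k m), dyadicCube k m

/-! ### Coverage: `|Γ ∖ F| = 0` -/

omit [Fintype ι] in
/-- A dyadic cube meeting `K₀` lies in `K₀`. [folklore] -/
theorem dyadicCube_subset_unitCube {k : ℕ} {m : ι → ℤ} {x : ι → ℝ} (hx : x ∈ dyadicCube k m)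
    (hx0 : x ∈ dyadicCube (ι := ι) 0 0) : dyadicCube k m ⊆ dyadicCube 0 0 := by
  rcases dyadicCube_subset_or_disjoint_of_le (Nat.zero_le k) (0 : ι → ℤ) m with h | h
  · exact h
  · exact absurd hx0 (disjoint_left.1 h hx)

/-- **A point lying in some dense dyadic cube lies in a selected cube** (the dense cube of least
generation through `x`). [cite: GilbargTrudinger2001, §9.2] -/
theorem mem_selectedUnion_of_exists_dense {t : ℝ≥0∞} {Γ : Set (ι → ℝ)} {x : ι → ℝ}
    (hx0 : x ∈ dyadicCube (ι := ι) 0 0) (h : ∃ k, IsDense t Γ k (index k x)) :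
    x ∈ selectedUnion t Γ := by
  classical
  set k := Nat.find h with hk
  have hdense : IsDense t Γ k (index k x) := Nat.find_spec h
  refine mem_iUnion.2 ⟨k, mem_iUnion.2 ⟨index k x, mem_iUnion.2 ⟨⟨?_, hdense, ?_⟩,
    mem_dyadicCube_index k x⟩⟩⟩
  · exact dyadicCube_subset_unitCube (mem_dyadicCube_index k x) hx0
  · intro k' m' hk' hsub hdense'
    have hx' : x ∈ dyadicCube k' m' := hsub (mem_dyadicCube_index k x)
    have hm' : m' = index k' x := index_unique hx'
    rw [hm'] at hdense'
    exact Nat.find_min h (by rw [← hk]; exact hk') hdense'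

/-- **Coverage (9.18)**: almost all of `Γ ⊆ K₀` is covered by the selected cubes, `|Γ ∖ F| = 0`,
for `t < 1`. [cite: GilbargTrudinger2001, §9.2, (9.18)] -/
theorem volume_diff_selectedUnion {t : ℝ≥0∞} (ht : t < 1) {Γ : Set (ι → ℝ)}
    (hΓm : MeasurableSet Γ) (hΓ0 : Γ ⊆ dyadicCube 0 0) :
    volume (Γ \ selectedUnion t Γ) = 0 := by
  have hae := ae_exists_dense_dyadicCube Γ ht
  rw [ae_restrict_iff' hΓm] at hae
  have hsub : Γ \ selectedUnion t Γ ⊆ {x | ¬ (x ∈ Γ → ∃ k, t * volume (dyadicCube k (index k x)) <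
      volume (Γ ∩ dyadicCube k (index k x)))} := by
    intro x hx hcontra
    exact hx.2 (mem_selectedUnion_of_exists_dense (hΓ0 hx.1) (hcontra hx.1))
  exact measure_mono_null hsub (ae_iff.1 hae)

/-! ### Parents: non-dense subcubes of `K₀`; maximal parents are disjoint -/

/-- A dense cube has positive measure intersection with `Γ`, hence is nonempty. [folklore] -/
theorem nonempty_of_isDense {t : ℝ≥0∞} {Γ : Set (ι → ℝ)} {k : ℕ} {m : ι → ℤ}
    (h : IsDense t Γ k m) : (dyadicCube k m).Nonempty := by
  by_contra hne
  rw [not_nonempty_iff_eq_empty] at hne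
  simp [IsDense, hne] at h

/-- If `K₀` itself is not dense, selected cubes have positive generation. [folklore] -/
theorem Selected.pos {t : ℝ≥0∞} {Γ : Set (ι → ℝ)} (h0 : ¬ IsDense t Γ 0 0) {k : ℕ} {m : ι → ℤ}
    (hs : Selected t Γ k m) : 0 < k := by
  by_contra hk
  have hk0 : k = 0 := by omega
  subst hk0
  obtain ⟨hsub, hdense, -⟩ := hs
  obtain ⟨x, hx⟩ := nonempty_of_isDense hdense
  have hm : m = 0 := by
    have h1 := index_unique hx
    have h2 := index_unique (hsub hx)
    rw [h1, ← h2]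
  subst hm
  exact h0 hdense

/-- **Parents are non-dense subcubes of `K₀` containing a selected child.**
[cite: GilbargTrudinger2001, §9.2, (9.16) for `K̃`] -/
theorem IsParent.not_isDense_and_subset {t : ℝ≥0∞} {Γ : Set (ι → ℝ)} {k : ℕ} {m : ι → ℤ}
    (hp : IsParent t Γ k m) :
    ¬ IsDense t Γ k m ∧ dyadicCube k m ⊆ dyadicCube 0 0 ∧
      ∃ m', Selected t Γ (k + 1) m' ∧ dyadicCube (k + 1) m' ⊆ dyadicCube k m := by
  obtain ⟨m', hs, rfl⟩ := hp
  have hchild : dyadicCube (k + 1) m' ⊆ dyadicCube k (parentIndex m') := dyadicCube_subset_parent k m'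
  refine ⟨hs.2.2 k (parentIndex m') (Nat.lt_succ_self k) hchild, ?_, m', hs, hchild⟩
  obtain ⟨x, hx⟩ := nonempty_of_isDense hs.2.1
  exact dyadicCube_subset_unitCube (hchild hx) (hs.1 (by exact hx))

/-- **Maximal parents**: parents not strictly contained in another parent. [folklore] -/
def IsMaxParent (t : ℝ≥0∞) (Γ : Set (ι → ℝ)) (k : ℕ) (m : ι → ℤ) : Prop :=
  IsParent t Γ k m ∧ ∀ k' m', IsParent t Γ k' m' → dyadicCube k m ⊆ dyadicCube k' m' →
    dyadicCube k' m' = dyadicCube k m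

/-- **Every parent lies in a maximal parent** (a containing parent of least generation is
maximal). [folklore] -/
theorem IsParent.exists_isMaxParent {t : ℝ≥0∞} {Γ : Set (ι → ℝ)} {k : ℕ} {m : ι → ℤ}
    (hp : IsParent t Γ k m) :
    ∃ k' m', IsMaxParent t Γ k' m' ∧ dyadicCube k m ⊆ dyadicCube k' m' := by
  classical
  have hex : ∃ k', ∃ m', IsParent t Γ k' m' ∧ dyadicCube k m ⊆ dyadicCube k' m' :=
    ⟨k, m, hp, subset_rfl⟩
  set k₀ := Nat.find hex with hk₀
  obtain ⟨m₀, hp₀, hsub₀⟩ := Nat.find_spec hex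
  refine ⟨k₀, m₀, ⟨hp₀, fun k' m' hp' hsub' ↦ ?_⟩, hsub₀⟩
  -- `k' ≥ k₀` by minimality, then nested-or-disjoint forces equality
  have hk' : k₀ ≤ k' := by
    by_contra hlt
    push Not at hlt
    exact Nat.find_min hex (by rw [← hk₀]; exact hlt) ⟨m', hp', hsub₀.trans hsub'⟩
  obtain ⟨x, hx⟩ : (dyadicCube k₀ m₀).Nonempty := by
    obtain ⟨-, -, m'', hs, hsub''⟩ := hp₀.not_isDense_and_subset
    obtain ⟨x, hx⟩ := nonempty_of_isDense hs.2.1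
    exact ⟨x, hsub'' hx⟩
  rcases dyadicCube_subset_or_disjoint_of_le hk' m₀ m' with h | h
  · exact Subset.antisymm h hsub'
  · exact absurd hx (disjoint_left.1 h (hsub' hx))

/-- **Two maximal parents are equal or disjoint.** [folklore] -/
theorem IsMaxParent.eq_or_disjoint {t : ℝ≥0∞} {Γ : Set (ι → ℝ)} {k k' : ℕ} {m m' : ι → ℤ}
    (h : IsMaxParent t Γ k m) (h' : IsMaxParent t Γ k' m') :
    dyadicCube k m = dyadicCube k' m' ∨ Disjoint (dyadicCube k m) (dyadicCube k' m') := by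
  rcases le_total k k' with hle | hle
  · rcases dyadicCube_subset_or_disjoint_of_le hle m m' with hs | hd
    · exact Or.inl ((h'.2 k m h.1 hs).symm ▸ rfl)
    · exact Or.inr hd.symm
  · rcases dyadicCube_subset_or_disjoint_of_le hle m' m with hs | hd
    · exact Or.inl (h.2 k' m' h'.1 hs).symm
    · exact Or.inr hd

/-- `F̃` is the union of the maximal parents. [folklore] -/
theorem parentUnion_eq_iUnion_max (t : ℝ≥0∞) (Γ : Set (ι → ℝ)) :
    parentUnion t Γ = ⋃ (k : ℕ) (m : ι → ℤ) (_ : IsMaxParent t Γ k m), dyadicCube k m := by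
  apply Subset.antisymm
  · intro x hx
    simp only [parentUnion, mem_iUnion] at hx
    obtain ⟨k, m, hp, hx⟩ := hx
    obtain ⟨k', m', hmax, hsub⟩ := hp.exists_isMaxParent
    exact mem_iUnion.2 ⟨k', mem_iUnion.2 ⟨m', mem_iUnion.2 ⟨hmax, hsub hx⟩⟩⟩
  · intro x hx
    simp only [mem_iUnion] at hx
    obtain ⟨k, m, hmax, hx⟩ := hx
    exact mem_iUnion.2 ⟨k, mem_iUnion.2 ⟨m, mem_iUnion.2 ⟨hmax.1, hx⟩⟩⟩

/-! ### (9.19)–(9.20) -/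

/-- `F̃` is measurable. [folklore] -/
theorem measurableSet_parentUnion (t : ℝ≥0∞) (Γ : Set (ι → ℝ)) :
    MeasurableSet (parentUnion t Γ) :=
  MeasurableSet.iUnion fun k ↦ MeasurableSet.iUnion fun m ↦ MeasurableSet.iUnion fun _ ↦
    measurableSet_dyadicCube k m

/-- **(9.19)**: `|Γ ∩ F̃| ≤ t|F̃|` — `F̃` is the disjoint countable union of the maximal parents, each
of which is non-dense. [cite: GilbargTrudinger2001, §9.2, (9.19)] -/
theorem volume_inter_parentUnion_le (t : ℝ≥0∞) {Γ : Set (ι → ℝ)} (hΓm : MeasurableSet Γ) :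
    volume (Γ ∩ parentUnion t Γ) ≤ t * volume (parentUnion t Γ) := by
  classical
  set f : {p : ℕ × (ι → ℤ) // IsMaxParent t Γ p.1 p.2} → Set (ι → ℝ) :=
    fun p ↦ dyadicCube p.1.1 p.1.2 with hf
  have hF : parentUnion t Γ = ⋃₀ range f := by
    rw [parentUnion_eq_iUnion_max, sUnion_range]
    ext x
    simp only [mem_iUnion, hf]
    constructor
    · rintro ⟨k, m, hmax, hx⟩; exact ⟨⟨(k, m), hmax⟩, hx⟩
    · rintro ⟨⟨⟨k, m⟩, hmax⟩, hx⟩; exact ⟨k, m, hmax, hx⟩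
  have hcount : (range f).Countable := countable_range f
  have hdisj : (range f).Pairwise Disjoint := by
    rintro _ ⟨p, rfl⟩ _ ⟨q, rfl⟩ hne
    rcases p.2.eq_or_disjoint q.2 with h | h
    · exact absurd h hne
    · exact h
  have hmeas : ∀ s ∈ range f, MeasurableSet s := by
    rintro _ ⟨p, rfl⟩; exact measurableSet_dyadicCube _ _
  rw [hF, inter_comm, ← Measure.restrict_apply' hΓm, measure_sUnion hcount hdisj hmeas,
    measure_sUnion hcount hdisj hmeas, ← ENNReal.tsum_mul_left]
  refine ENNReal.tsum_le_tsum fun s ↦ ?_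
  obtain ⟨p, hp⟩ := s.2
  rw [Measure.restrict_apply' hΓm, ← hp]
  have hnd := p.2.1.not_isDense_and_subset.1
  rw [IsDense, not_lt] at hnd
  simpa [hf, inter_comm] using hnd

/-- Selected cubes lie in `F̃` (each inside its parent). [folklore] -/
theorem selectedUnion_subset_parentUnion {t : ℝ≥0∞} {Γ : Set (ι → ℝ)} (h0 : ¬ IsDense t Γ 0 0) :
    selectedUnion t Γ ⊆ parentUnion t Γ := by
  intro x hx
  simp only [selectedUnion, mem_iUnion] at hx
  obtain ⟨k, m, hs, hx⟩ := hx
  obtain ⟨k', rfl⟩ : ∃ k', k = k' + 1 := ⟨k - 1, (Nat.succ_pred_eq_of_pos (hs.pos h0)).symm⟩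
  exact mem_iUnion.2 ⟨k', mem_iUnion.2 ⟨parentIndex m, mem_iUnion.2 ⟨⟨m, hs, rfl⟩,
    dyadicCube_subset_parent k' m hx⟩⟩⟩

/-- The density hypothesis at the top: `|Γ| ≤ t = t|K₀|` means `K₀` is not dense.
[cite: GilbargTrudinger2001, §9.2, `∫_{K₀} f ≤ t|K₀|`] -/
theorem not_isDense_unitCube {t : ℝ≥0∞} {Γ : Set (ι → ℝ)} (hΓ0 : Γ ⊆ dyadicCube 0 0)
    (hΓt : volume Γ ≤ t) : ¬ IsDense t Γ 0 0 := by
  rw [IsDense, not_lt, volume_dyadicCube, inter_eq_left.2 hΓ0]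
  simpa using hΓt

/-- **Gilbarg–Trudinger (9.20)**: for a measurable `Γ ⊆ K₀ = [0,1)ⁿ` with `|Γ| ≤ t < 1`,
`|Γ| ≤ t |F̃|`, where `F̃` is the union of the parents of the cubes selected by the dyadic stopping
time for `χ_Γ` at level `t`. [cite: GilbargTrudinger2001, §9.2, (9.20)] -/
theorem volume_le_mul_volume_parentUnion {t : ℝ≥0∞} (ht : t < 1) {Γ : Set (ι → ℝ)}
    (hΓm : MeasurableSet Γ) (hΓ0 : Γ ⊆ dyadicCube 0 0) (hΓt : volume Γ ≤ t) :
    volume Γ ≤ t * volume (parentUnion t Γ) := by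
  have h0 := not_isDense_unitCube hΓ0 hΓt
  have hnull : volume (Γ \ parentUnion t Γ) = 0 :=
    measure_mono_null (sdiff_subset_sdiff_right (selectedUnion_subset_parentUnion h0))
      (volume_diff_selectedUnion ht hΓm hΓ0)
  calc volume Γ = volume (Γ ∩ parentUnion t Γ) + volume (Γ \ parentUnion t Γ) :=
        (measure_inter_add_sdiff Γ (measurableSet_parentUnion t Γ)).symm
    _ ≤ t * volume (parentUnion t Γ) + 0 := by
        rw [hnull, add_zero, add_zero]; exact volume_inter_parentUnion_le t hΓm
    _ = t * volume (parentUnion t Γ) := add_zero _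

end Literature.MeasureTheory.Covering.Dyadic

end
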